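import Summits.QuantumFields.BalabanUV.T4Continuum.Support.NE3FramePotBoundW
import HarnessLib

/-!
# T⁴ programme, node NE3, route (H♮) rows H4 ∕ H4-W (= K5-spk) — THE SHARP FRAME BOUND: `Dfp d L ↦ d·L`
# `Σ_{z∈periodBox N} ‖framePot L k Y z‖² ≤ 12·(d·L)·l2sq Y` (flat; the curved twin `48·(d·L)` is the companion file `NE3FramePotBoundWSharp`)
NE3 formalisation swarm `b2b-balaban-t4-ne3-formalise-*`, LEAF PROVER 04 (gen 6), the author lineage of H4 `NE3FramePotBound` (p225364, g4) and
H4-W `NE3FramePotBoundW` (p232724, g5).  The row's standing disprover located THE BINDING LINE of route H♮'s smallness census in the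
crude constant of those two files (journal D-ne3r2-g9-3 (5)): `Dfp d L = (dL)²·d·(2dL+1)^{2d}` (≈ 1.79·10¹² at d = 4, L = 2; spike constant
`48·Dfp ≈ 8.6·10¹³`), which came from bounding EVERY letter of a tree contour by the ℓ¹ norm of the whole l¹-box of radius `dL` around
the block corner (`lnorm_le_region`) and then counting box multiplicities.  THE BOX IS NOT NEEDED: the tree contour `Γ_{q, q+r}` of
B5 (1.7) (`treeWord (boxVec L r)`, `treeWord_upper_succ`) is a staircase of at most `d` straight segments INSIDE THE BLOCK `q + [0,L)^d`,
the segment in direction `κ` being a sub-segment of ONE `κ`-line of the block; Cauchy–Schwarz along each segment and then over the `≤ d`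
segments gives, for EVERY `r`,

  `lnorm Y q (treeWord (boxVec L r)) ≤ Σ_κ √(L·Σ_{v∈periodBox L} ‖Y (q+v) κ‖²)`,  hence  `‖frameLin L U Y q‖² ≤ d·L·Σ_{v∈periodBox L} Σ_κ ‖Y (q+v) κ‖²`

at ANY unitary background `U` (transports are isometries: `norm_dhol_le`; the `L^{−d}` weights sum to one) — the block's OWN energy, with
multiplicity ONE: the blocks tile the torus exactly (`NE3BlockPoincareCore.sum_blocks_torus`) and the sparse centres `(L^j)•z`, `z ∈ periodBox N`,
inject into `periodBox (L^j·N)`.  With H4 ∕ H4-W's level weights `(L²∕L^d)^m` ∕ `4·(L²∕L^d)^m` (`l2sq_iterate_Qcoarse_le`, `l2sq_QbarIter_le` BY NAME)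
and the same Sedrakyan `(3∕4)^m` bookkeeping, the two ENDs follow with the SAME BINDERS as the landed ENDs and `Dfp d L` replaced by `d·L`:
d = 4, L = 2: flat `12·8 = 96` (was `2.1·10¹³`), curved `48·8 = 384` (was `8.6·10¹³`).

CONTENT (all [folklore]; 0 sorry; 0 def):
§1 `lnorm_append`; `sum_range_norm_le_sqrt_line` (a straight sub-segment of a block line against the block's line energy);
   `lnorm_treeWord_upper_le` ∕ `lnorm_treeWord_boxVec_le` ∕ `lnorm_treeWord_boxVec_sq_le` (the staircase, `≤ Σ_κ √(L·E_κ)`, squared `≤ d·L·E`);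
   **`norm_frameLin_sq_le_block`** (any unitary `U`), `norm_Fbar_sq_le_block`, `norm_Fcoarse_sq_le_block` (flat, via `Fbar_flat`);
§2 `sum_periodBox_pow_smul_le` (sparse sampling of a non-negative site function), **`sum_norm_Fbar_sq_le_torus`** (one level on the torus:
   `Σ_{z∈periodBox N} ‖Fbar L U V ((L^j)•z)‖² ≤ d·L·l2sq (periodBox (L^{j+1}·N)) V` — NO periodicity, NO box);
§3 `sum_norm_Fcoarse_iterate_sq_le_sharp`, **`sum_norm_framePot_sq_le_sharp`** (flat END, H4's binders verbatim, constant `12·(d·L)`);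
the curved END♯ `sum_norm_framePotW_sq_le_sharp` (H4-W's binders verbatim, `48·(d·L)`) is the companion file `NE3FramePotBoundWSharp`.
H4 and H4-W stay as landed (nothing re-filed; importers unchanged); consumers (H5a's `hF`, K6c's spike letter `C_F`) instantiate either by name.

HONEST FRAMING.  Lattice kinematics on OUR frame: a displayed constant of the (P♮)_W census shrinks, nothing else; nothing about Bałaban's
minimisers; (P♮)_W, (ML_w) at W ≠ 1, T-E_w and NE3 are NOT proved; spine PROVED 0∕9; finite T⁴ rung (B)+1 — NOT infinite volume, NOT mass
gap, NOT BetaPertH, NOT Clay.  ABSOLUTE RULE kept (no printed sentence is a hypothesis; context only: [Balaban1985Averaging] (110)–(112) p. 34,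
B5 (1.7)).  PLACEMENT: `Summits/QuantumFields/BalabanUV/`; imports the accepted H4-W only.
HONEST DEPENDENCY: continuum YM on T⁴ ⇐ BetaPertH ∧ nine spine estimates (0/9 proved); BetaPertH ⇐ (D1) ∧ (D4) ∧ CAP+tail; G-an2-4
gates asym, D1 and NE2/3/4.
-/

set_option autoImplicit false

open scoped BigOperators Matrix.Norms.L2Operator
open Finset

namespace Summit.QuantumFields.BalabanUV.T4Continuum.NE3FramePotBoundSharp

open Literature.MathematicalPhysics.QuantumFieldTheory.Balaban1983to89
open B7Prop1Explicit B7Prop2Explicit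
open T4AveragingDeficitWall (IsUnitaryCfg SmallField)
open T4AveragingDeficitWallBoundary (periodBox IsPeriodicCfg mem_periodBox)
open AveragingDeficitPeriodicCounting (IsPeriodicDir)
open AveragingDeficitTransport (lnorm lnorm_cons dhol norm_dhol_le)
open AveragingDeficitNearIdentity (lnorm_nonneg)
open BlockAveragePushDirSplit (frameLin flat sum_blockWeight_eq_one)
open BlockAverageLoopFlux (upper upper_zero upper_apply_of_le upper_apply_of_lt treeWord_upper_succ)
open BlockAverageDbarLinNorms (lnorm_seg_eq_sum)
open NE3TangentFlatStructure (Qcoarse Fcoarse framePot)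
open NE3TangentCovariantStructure (Fbar)
open NE3TangentCovariantTower (Fbar_flat)
open NE3BlockPoincareCore (sum_blocks_torus)
open NE3CovariantLineSumsL2 (l2sq l2sq_nonneg)
open NE3FramePotBound (isUnitaryCfg_flat framePot_eq_sum l2sq_iterate_Qcoarse_le ratio_le geom_sum_le_inv)

noncomputable section

variable {d : ℕ} {n : Type*} [Fintype n] [DecidableEq n]

/-! ## §1 A tree contour against its own block -/

/-- `lnorm` is additive over concatenation, the second word being read from the displaced point. [folklore] -/
theorem lnorm_append (ψ : Site d → Fin d → Matrix n n ℂ) :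
    ∀ (x : Site d) (w₁ w₂ : List (Letter d)), lnorm ψ x (w₁ ++ w₂) = lnorm ψ x w₁ + lnorm ψ (x + disp w₁) w₂
  | x, [], w₂ => by simp
  | x, l :: w₁, w₂ => by
      rw [List.cons_append, lnorm_cons, lnorm_cons, lnorm_append ψ (x + l.vec) w₁ w₂, disp_cons]
      simp only [add_assoc]

/-- **A STRAIGHT SUB-SEGMENT OF ONE LINE OF THE BLOCK AGAINST THE BLOCK'S LINE ENERGY**: for an offset `u ∈ [0,L)^d` with `u_κ = 0` and
`t ≤ L`, `Σ_{i<t} ‖Y (q + u + i•e_κ) κ‖ ≤ √(L·Σ_{v∈periodBox L} ‖Y (q+v) κ‖²)` (extend to the full line, Cauchy–Schwarz, the line's sites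
are distinct sites of the block). [folklore] -/
theorem sum_range_norm_le_sqrt_line {L : ℕ} (Y : Site d → Fin d → Matrix n n ℂ) (q u : Site d) (κ : Fin d)
    (hu : ∀ j, 0 ≤ u j ∧ u j < L) (huκ : u κ = 0) {t : ℕ} (ht : t ≤ L) :
    ∑ i ∈ range t, ‖Y (q + u + (i : ℤ) • e κ) κ‖
      ≤ Real.sqrt ((L : ℝ) * ∑ v ∈ periodBox (d := d) L, ‖Y (q + v) κ‖ ^ 2) := by
  set f : ℕ → ℝ := fun i => ‖Y (q + u + (i : ℤ) • e κ) κ‖ with hf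
  have hf0 : ∀ i, 0 ≤ f i := fun i => norm_nonneg _
  -- (a) extend the segment to the full line
  have h1 : ∑ i ∈ range t, f i ≤ ∑ i ∈ range L, f i :=
    Finset.sum_le_sum_of_subset_of_nonneg (Finset.range_mono ht) fun i _ _ => hf0 i
  -- (b) Cauchy–Schwarz on the line
  have h2 : (∑ i ∈ range L, f i) ^ 2 ≤ (L : ℝ) * ∑ i ∈ range L, f i ^ 2 := by
    have h := sq_sum_le_card_mul_sum_sq (s := range L) (f := f)
    simpa only [Finset.card_range] using h
  -- (c) the line's sites are distinct sites of the block
  set φ : ℕ → Site d := fun i => u + (i : ℤ) • e κ with hφ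
  have hφκ : ∀ i : ℕ, φ i κ = (i : ℤ) := fun i => by
    simp only [hφ, Pi.add_apply, Pi.smul_apply, e_apply, if_true, smul_eq_mul, mul_one, huκ, zero_add]
  have hφj : ∀ (i : ℕ) (j : Fin d), j ≠ κ → φ i j = u j := fun i j hj => by
    simp only [hφ, Pi.add_apply, Pi.smul_apply, e_apply, if_neg hj, smul_eq_mul, mul_zero, add_zero]
  have hinj : Set.InjOn φ ↑(range L) := by
    intro i _ i' _ h
    have hκ := congr_fun h κ
    rw [hφκ, hφκ] at hκ
    exact_mod_cast hκ
  have himg : (range L).image φ ⊆ periodBox (d := d) L := by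
    intro v hv
    obtain ⟨i, hi, rfl⟩ := Finset.mem_image.mp hv
    have hiL : i < L := Finset.mem_range.mp hi
    rw [mem_periodBox]
    intro j
    by_cases hj : j = κ
    · subst hj; rw [hφκ]; exact ⟨by positivity, by exact_mod_cast hiL⟩
    · rw [hφj i j hj]; exact hu j
  have h3 : ∑ i ∈ range L, f i ^ 2 ≤ ∑ v ∈ periodBox (d := d) L, ‖Y (q + v) κ‖ ^ 2 := by
    have e1 : ∑ i ∈ range L, f i ^ 2 = ∑ v ∈ (range L).image φ, ‖Y (q + v) κ‖ ^ 2 := by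
      rw [Finset.sum_image hinj]
      refine Finset.sum_congr rfl fun i _ => ?_
      simp only [hf, hφ, add_assoc]
    rw [e1]
    exact Finset.sum_le_sum_of_subset_of_nonneg himg fun v _ _ => sq_nonneg _
  -- assemble
  have hsum0 : 0 ≤ ∑ i ∈ range L, f i := Finset.sum_nonneg fun i _ => hf0 i
  have h4 : (∑ i ∈ range L, f i) ^ 2 ≤ (L : ℝ) * ∑ v ∈ periodBox (d := d) L, ‖Y (q + v) κ‖ ^ 2 :=
    h2.trans (mul_le_mul_of_nonneg_left h3 (Nat.cast_nonneg L))
  calc ∑ i ∈ range t, f i ≤ ∑ i ∈ range L, f i := h1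
    _ ≤ |∑ i ∈ range L, f i| := le_abs_self _
    _ ≤ Real.sqrt ((L : ℝ) * ∑ v ∈ periodBox (d := d) L, ‖Y (q + v) κ‖ ^ 2) := Real.abs_le_sqrt h4

/-- **THE STAIRCASE, BY DESCENDING INDUCTION ON THE DIRECTIONS** (`treeWord_upper_succ`: the coordinates are changed in the order
`d−1, …, 0`): the tail `Γ_{q, q + upper (d−i) r}` of the tree contour costs at most `Σ_{κ ≥ d−i} √(L·E_κ)`, `E_κ` the block's `κ`-energy —
each segment is a sub-segment of a block line starting at an offset with vanishing `κ`-coordinate. [folklore] -/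
theorem lnorm_treeWord_upper_le {L : ℕ} (hL : 1 ≤ L) (Y : Site d → Fin d → Matrix n n ℂ) (q : Site d) (r : Fin d → Fin L) :
    ∀ i : ℕ, i ≤ d → lnorm Y q (treeWord (upper (d - i) (boxVec L r)))
      ≤ ∑ κ : Fin d, if d - i ≤ (κ : ℕ) then Real.sqrt ((L : ℝ) * ∑ v ∈ periodBox (d := d) L, ‖Y (q + v) κ‖ ^ 2) else 0
  | 0, _ => by
      have h0 : upper d (boxVec L r) = (0 : Site d) := funext fun j => upper_apply_of_lt _ j.2
      rw [Nat.sub_zero, h0, treeWord_zero, AveragingDeficitTransport.lnorm_nil]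
      exact Finset.sum_nonneg fun κ _ => by split_ifs <;> first | exact Real.sqrt_nonneg _ | exact le_rfl
  | i + 1, hi => by
      -- the direction processed at this step
      obtain ⟨m, hm⟩ : ∃ m : ℕ, m = d - (i + 1) := ⟨_, rfl⟩
      have hmd : m < d := by omega
      have hm1 : m + 1 = d - i := by omega
      have ih := lnorm_treeWord_upper_le hL Y q r i (by omega)
      rw [← hm1] at ih
      rw [← hm]
      set μ : Fin d := ⟨m, hmd⟩ with hμ
      have hμv : (μ : ℕ) = m := rfl
      have hsplit := treeWord_upper_succ μ (boxVec L r)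
      rw [hμv] at hsplit
      rw [hsplit, lnorm_append, disp_treeWord]
      -- the segment term
      have hseg : lnorm Y (q + upper (m + 1) (boxVec L r)) (seg μ (boxVec L r μ))
          ≤ Real.sqrt ((L : ℝ) * ∑ v ∈ periodBox (d := d) L, ‖Y (q + v) μ‖ ^ 2) := by
        have hv : boxVec L r μ = ((r μ : ℕ) : ℤ) := rfl
        rw [hv, lnorm_seg_eq_sum]
        refine sum_range_norm_le_sqrt_line Y q _ μ (fun j => ?_) ?_ (r μ).2.le
        · by_cases hj : m + 1 ≤ (j : ℕ)
          · rw [upper_apply_of_le _ hj]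
            exact ⟨by simp [boxVec], by simp [boxVec]⟩
          · rw [upper_apply_of_lt _ (by omega)]
            exact ⟨le_rfl, by exact_mod_cast hL⟩
        · exact upper_apply_of_lt _ (by rw [hμv]; omega)
      -- the right-hand side splits off the term `κ = μ`
      have hrhs : (∑ κ : Fin d, if m ≤ (κ : ℕ) then Real.sqrt ((L : ℝ) * ∑ v ∈ periodBox (d := d) L, ‖Y (q + v) κ‖ ^ 2) else 0)
          = Real.sqrt ((L : ℝ) * ∑ v ∈ periodBox (d := d) L, ‖Y (q + v) μ‖ ^ 2)
            + ∑ κ : Fin d, if m + 1 ≤ (κ : ℕ) then Real.sqrt ((L : ℝ) * ∑ v ∈ periodBox (d := d) L, ‖Y (q + v) κ‖ ^ 2) else 0 := by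
        have hpt : ∀ κ : Fin d,
            (if m ≤ (κ : ℕ) then Real.sqrt ((L : ℝ) * ∑ v ∈ periodBox (d := d) L, ‖Y (q + v) κ‖ ^ 2) else 0)
              = (if κ = μ then Real.sqrt ((L : ℝ) * ∑ v ∈ periodBox (d := d) L, ‖Y (q + v) κ‖ ^ 2) else 0)
                + (if m + 1 ≤ (κ : ℕ) then Real.sqrt ((L : ℝ) * ∑ v ∈ periodBox (d := d) L, ‖Y (q + v) κ‖ ^ 2) else 0) := by
          intro κ
          by_cases hκ : κ = μ
          · subst hκ
            rw [if_pos (le_of_eq hμv.symm), if_pos rfl, if_neg (by rw [hμv]; omega), add_zero]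
          · have hne : (κ : ℕ) ≠ m := fun h => hκ (Fin.ext (by rw [h, hμv]))
            rw [if_neg hκ, zero_add]
            by_cases hle : m + 1 ≤ (κ : ℕ)
            · rw [if_pos hle, if_pos (by omega)]
            · rw [if_neg hle, if_neg (by omega)]
        rw [Finset.sum_congr rfl fun κ _ => hpt κ, Finset.sum_add_distrib, Finset.sum_ite_eq' univ μ, if_pos (Finset.mem_univ _)]
      rw [hrhs]
      linarith [ih, hseg]

/-- **THE WHOLE TREE CONTOUR `Γ_{q, q+r}` AGAINST THE BLOCK `q + [0,L)^d`**: `lnorm Y q (treeWord (boxVec L r)) ≤ Σ_κ √(L·Σ_{v∈periodBox L} ‖Y (q+v) κ‖²)`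
for EVERY `r` (a bound independent of `r`). [folklore] -/
theorem lnorm_treeWord_boxVec_le {L : ℕ} (hL : 1 ≤ L) (Y : Site d → Fin d → Matrix n n ℂ) (q : Site d) (r : Fin d → Fin L) :
    lnorm Y q (treeWord (boxVec L r)) ≤ ∑ κ : Fin d, Real.sqrt ((L : ℝ) * ∑ v ∈ periodBox (d := d) L, ‖Y (q + v) κ‖ ^ 2) := by
  have h := lnorm_treeWord_upper_le hL Y q r d le_rfl
  rw [Nat.sub_self, upper_zero] at h
  exact h.trans (le_of_eq (Finset.sum_congr rfl fun κ _ => if_pos (Nat.zero_le _)))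

/-- … squared, by Cauchy–Schwarz over the `d` directions: `lnorm² ≤ d·L·Σ_{v∈periodBox L} Σ_κ ‖Y (q+v) κ‖²`. [folklore] -/
theorem lnorm_treeWord_boxVec_sq_le {L : ℕ} (hL : 1 ≤ L) (Y : Site d → Fin d → Matrix n n ℂ) (q : Site d) (r : Fin d → Fin L) :
    lnorm Y q (treeWord (boxVec L r)) ^ 2 ≤ ((d : ℝ) * L) * ∑ v ∈ periodBox (d := d) L, ∑ κ : Fin d, ‖Y (q + v) κ‖ ^ 2 := by
  set E : Fin d → ℝ := fun κ => ∑ v ∈ periodBox (d := d) L, ‖Y (q + v) κ‖ ^ 2 with hE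
  have hE0 : ∀ κ, 0 ≤ (L : ℝ) * E κ := fun κ => by positivity
  have h1 := lnorm_treeWord_boxVec_le hL Y q r
  have h0 : 0 ≤ lnorm Y q (treeWord (boxVec L r)) := lnorm_nonneg _ _ _
  have h2 : (∑ κ : Fin d, Real.sqrt ((L : ℝ) * E κ)) ^ 2 ≤ (d : ℝ) * ∑ κ : Fin d, Real.sqrt ((L : ℝ) * E κ) ^ 2 := by
    have h := sq_sum_le_card_mul_sum_sq (s := (univ : Finset (Fin d))) (f := fun κ => Real.sqrt ((L : ℝ) * E κ))
    simpa only [Finset.card_univ, Fintype.card_fin] using h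
  have h3 : ∑ κ : Fin d, Real.sqrt ((L : ℝ) * E κ) ^ 2 = (L : ℝ) * ∑ v ∈ periodBox (d := d) L, ∑ κ : Fin d, ‖Y (q + v) κ‖ ^ 2 := by
    rw [Finset.sum_congr rfl fun κ _ => Real.sq_sqrt (hE0 κ), ← Finset.mul_sum, Finset.sum_comm]
  calc lnorm Y q (treeWord (boxVec L r)) ^ 2 ≤ (∑ κ : Fin d, Real.sqrt ((L : ℝ) * E κ)) ^ 2 := pow_le_pow_left₀ h0 h1 2
    _ ≤ (d : ℝ) * ∑ κ : Fin d, Real.sqrt ((L : ℝ) * E κ) ^ 2 := h2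
    _ = ((d : ℝ) * L) * ∑ v ∈ periodBox (d := d) L, ∑ κ : Fin d, ‖Y (q + v) κ‖ ^ 2 := by rw [h3]; ring

/-- **ONE LINEARISED BLOCK FRAME AGAINST ITS OWN BLOCK** (any unitary `U`): `‖frameLin L U Y q‖² ≤ d·L·Σ_{v∈periodBox L} Σ_κ ‖Y (q+v) κ‖²` —
every transported tree-contour sum is bounded by the contour's `lnorm` (`norm_dhol_le`), every contour by the SAME block quantity, and the
weights `L^{−d}` sum to one. [folklore] -/
theorem norm_frameLin_sq_le_block {L : ℕ} (hL : 1 ≤ L) {U : Site d → Fin d → (Matrix n n ℂ)ˣ} (hU : IsUnitaryCfg U)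
    (Y : Site d → Fin d → Matrix n n ℂ) (q : Site d) :
    ‖frameLin L U Y q‖ ^ 2 ≤ ((d : ℝ) * L) * ∑ v ∈ periodBox (d := d) L, ∑ κ : Fin d, ‖Y (q + v) κ‖ ^ 2 := by
  set E : ℝ := ∑ v ∈ periodBox (d := d) L, ∑ κ : Fin d, ‖Y (q + v) κ‖ ^ 2 with hE
  have hE0 : 0 ≤ ((d : ℝ) * L) * E := by positivity
  set B : ℝ := Real.sqrt (((d : ℝ) * L) * E) with hB
  have hB0 : 0 ≤ B := Real.sqrt_nonneg _
  have hpath : ∀ r : Fin d → Fin L, ‖dhol U Y q (treeWord (boxVec L r))‖ ≤ B := by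
    intro r
    refine (norm_dhol_le hU Y q _).trans ?_
    exact (le_abs_self _).trans (Real.abs_le_sqrt (lnorm_treeWord_boxVec_sq_le hL Y q r))
  have hwt := sum_blockWeight_eq_one (d := d) L hL
  have h1 : ‖frameLin L U Y q‖ ≤ B := by
    unfold frameLin
    calc ‖∑ r : Fin d → Fin L, (((L : ℝ) ^ d)⁻¹) • dhol U Y q (treeWord (boxVec L r))‖
        ≤ ∑ r : Fin d → Fin L, ‖(((L : ℝ) ^ d)⁻¹) • dhol U Y q (treeWord (boxVec L r))‖ := norm_sum_le _ _
      _ ≤ ∑ _r : Fin d → Fin L, ((L : ℝ) ^ d)⁻¹ * B := by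
          refine Finset.sum_le_sum fun r _ => ?_
          rw [norm_smul, Real.norm_eq_abs, abs_of_nonneg (by positivity)]
          exact mul_le_mul_of_nonneg_left (hpath r) (by positivity)
      _ = B := by rw [← Finset.sum_mul, hwt, one_mul]
  calc ‖frameLin L U Y q‖ ^ 2 ≤ B ^ 2 := pow_le_pow_left₀ (norm_nonneg _) h1 2
    _ = ((d : ℝ) * L) * E := Real.sq_sqrt hE0

/-- The same bound for the frame read on the coarse lattice, `Fbar L U Y y = frameLin L U Y (L•y)`: the block `L•y + [0,L)^d`. [folklore] -/
theorem norm_Fbar_sq_le_block {L : ℕ} (hL : 1 ≤ L) {U : Site d → Fin d → (Matrix n n ℂ)ˣ} (hU : IsUnitaryCfg U)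
    (Y : Site d → Fin d → Matrix n n ℂ) (y : Site d) :
    ‖Fbar L U Y y‖ ^ 2 ≤ ((d : ℝ) * L) * ∑ v ∈ periodBox (d := d) L, ∑ κ : Fin d, ‖Y ((L : ℤ) • y + v) κ‖ ^ 2 :=
  norm_frameLin_sq_le_block hL hU Y ((L : ℤ) • y)

/-- The flat block-tree average (`Fcoarse = Fbar` at `W = 1`, `Fbar_flat`): `‖Fcoarse L Y y‖² ≤ d·L·Σ_{v∈periodBox L} Σ_κ ‖Y (L•y+v) κ‖²`. [folklore] -/
theorem norm_Fcoarse_sq_le_block {L : ℕ} (hL : 1 ≤ L) (Y : Site d → Fin d → Matrix n n ℂ) (y : Site d) :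
    ‖Fcoarse L Y y‖ ^ 2 ≤ ((d : ℝ) * L) * ∑ v ∈ periodBox (d := d) L, ∑ κ : Fin d, ‖Y ((L : ℤ) • y + v) κ‖ ^ 2 := by
  rw [← Fbar_flat]
  exact norm_Fbar_sq_le_block hL isUnitaryCfg_flat Y y

/-! ## §2 One level on the torus: sparse centres inject, blocks tile -/

omit [Fintype n] [DecidableEq n] in
/-- **SPARSE SAMPLING**: for a non-negative site function `G`, `Σ_{z∈periodBox N} G ((L^j)•z) ≤ Σ_{y∈periodBox (L^j·N)} G y`
(the dilation `z ↦ (L^j)•z` maps `periodBox N` injectively into `periodBox (L^j·N)`). [folklore] -/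
theorem sum_periodBox_pow_smul_le {L : ℕ} (hL : 1 ≤ L) (j N : ℕ) (G : Site d → ℝ) (hG : ∀ y, 0 ≤ G y) :
    ∑ z ∈ periodBox (d := d) N, G (((L : ℤ) ^ j) • z) ≤ ∑ y ∈ periodBox (d := d) (L ^ j * N), G y := by
  set c : ℤ := (L : ℤ) ^ j with hc
  have hc0 : 0 < c := by rw [hc]; exact pow_pos (by exact_mod_cast hL) j
  have hinj : Set.InjOn (fun z : Site d => c • z) ↑(periodBox (d := d) N) := by
    intro z _ z' _ h
    funext i
    have hi := congr_fun h i
    simp only [Pi.smul_apply, smul_eq_mul] at hi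
    exact mul_left_cancel₀ hc0.ne' hi
  have himg : (periodBox (d := d) N).image (fun z : Site d => c • z) ⊆ periodBox (d := d) (L ^ j * N) := by
    intro y hy
    obtain ⟨z, hz, rfl⟩ := Finset.mem_image.mp hy
    rw [mem_periodBox] at hz ⊢
    intro κ
    obtain ⟨h0, h1⟩ := hz κ
    refine ⟨?_, ?_⟩
    · simp only [Pi.smul_apply, smul_eq_mul]; exact mul_nonneg hc0.le h0
    · simp only [Pi.smul_apply, smul_eq_mul]
      have h2 : c * z κ < c * (N : ℤ) := mul_lt_mul_of_pos_left h1 hc0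
      have e : ((L ^ j * N : ℕ) : ℤ) = c * (N : ℤ) := by rw [hc]; push_cast; ring
      rw [e]; exact h2
  calc ∑ z ∈ periodBox (d := d) N, G (c • z) = ∑ y ∈ (periodBox (d := d) N).image (fun z : Site d => c • z), G y :=
        (Finset.sum_image hinj).symm
    _ ≤ ∑ y ∈ periodBox (d := d) (L ^ j * N), G y := Finset.sum_le_sum_of_subset_of_nonneg himg fun y _ _ => hG y

/-- **ONE LEVEL ON THE TORUS, SHARP** (any unitary `U`, any `V`, no periodicity needed): the frames read at the sparse centres `(L^j)•z`,
`z ∈ periodBox N`, against the exact block tiling of `periodBox (L^{j+1}·N)`: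
`Σ_{z∈periodBox N} ‖Fbar L U V ((L^j)•z)‖² ≤ d·L·l2sq (periodBox (L^{j+1}·N)) V`. [folklore] -/
theorem sum_norm_Fbar_sq_le_torus {L : ℕ} (hL : 1 ≤ L) (j N : ℕ) {U : Site d → Fin d → (Matrix n n ℂ)ˣ} (hU : IsUnitaryCfg U)
    (V : Site d → Fin d → Matrix n n ℂ) :
    ∑ z ∈ periodBox (d := d) N, ‖Fbar L U V (((L : ℤ) ^ j) • z)‖ ^ 2 ≤ ((d : ℝ) * L) * l2sq (periodBox (d := d) (L ^ (j + 1) * N)) V := by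
  have h1 := sum_periodBox_pow_smul_le (d := d) hL j N (fun y => ‖Fbar L U V y‖ ^ 2) fun y => sq_nonneg _
  have h2 : ∑ y ∈ periodBox (d := d) (L ^ j * N), ‖Fbar L U V y‖ ^ 2
      ≤ ∑ y ∈ periodBox (d := d) (L ^ j * N), ((d : ℝ) * L) * ∑ v ∈ periodBox (d := d) L, ∑ κ : Fin d, ‖V ((L : ℤ) • y + v) κ‖ ^ 2 :=
    Finset.sum_le_sum fun y _ => norm_Fbar_sq_le_block hL hU V y
  have h3 : ∑ y ∈ periodBox (d := d) (L ^ j * N), ∑ v ∈ periodBox (d := d) L, ∑ κ : Fin d, ‖V ((L : ℤ) • y + v) κ‖ ^ 2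
      = l2sq (periodBox (d := d) (L ^ (j + 1) * N)) V := by
    rw [sum_blocks_torus hL (L ^ j * N) (fun x => ∑ κ : Fin d, ‖V x κ‖ ^ 2),
      show L * (L ^ j * N) = L ^ (j + 1) * N by ring]
    rfl
  calc ∑ z ∈ periodBox (d := d) N, ‖Fbar L U V (((L : ℤ) ^ j) • z)‖ ^ 2
      ≤ ∑ y ∈ periodBox (d := d) (L ^ j * N), ‖Fbar L U V y‖ ^ 2 := h1
    _ ≤ ∑ y ∈ periodBox (d := d) (L ^ j * N), ((d : ℝ) * L) * ∑ v ∈ periodBox (d := d) L, ∑ κ : Fin d, ‖V ((L : ℤ) • y + v) κ‖ ^ 2 := h2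
    _ = ((d : ℝ) * L) * l2sq (periodBox (d := d) (L ^ (j + 1) * N)) V := by rw [← Finset.mul_sum, h3]

/-! ## §3 The flat frame bound, sharp -/

/-- **ONE LEVEL ON THE TORUS (flat), SHARP**: for `j + 1 + m` levels and an `(L^{j+1+m}·N)`-periodic `Y`,
`Σ_{z∈periodBox N} ‖Fcoarse L ((Qcoarse L)^[m] Y) ((L^j)•z)‖² ≤ (d·L)·(L²∕L^d)^m·l2sq (periodBox (L^{j+1+m}·N)) Y` — H4's
`sum_norm_Fcoarse_iterate_sq_le` with `Dfp d L` replaced by `d·L`. [folklore] -/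
theorem sum_norm_Fcoarse_iterate_sq_le_sharp {L : ℕ} (hL : 1 ≤ L) {N : ℕ} (hN : 1 ≤ N) (j m : ℕ) {Y : Site d → Fin d → Matrix n n ℂ}
    (hY : IsPeriodicDir Y ((L ^ (j + 1 + m) * N : ℕ) : ℤ)) :
    ∑ z ∈ periodBox (d := d) N, ‖Fcoarse L ((Qcoarse L)^[m] Y) (((L : ℤ) ^ j) • z)‖ ^ 2
      ≤ ((d : ℝ) * L) * ((L : ℝ) ^ 2 / (L : ℝ) ^ d) ^ m * l2sq (periodBox (d := d) (L ^ (j + 1 + m) * N)) Y := by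
  have hPe : L ^ (j + 1 + m) * N = L ^ m * (L ^ (j + 1) * N) := by ring
  have hP : 1 ≤ L ^ (j + 1) * N := Nat.one_le_iff_ne_zero.mpr (Nat.mul_ne_zero (pow_ne_zero _ (by omega)) (by omega))
  have h1 : ∑ z ∈ periodBox (d := d) N, ‖Fcoarse L ((Qcoarse L)^[m] Y) (((L : ℤ) ^ j) • z)‖ ^ 2
      ≤ ((d : ℝ) * L) * l2sq (periodBox (d := d) (L ^ (j + 1) * N)) ((Qcoarse L)^[m] Y) := by
    have h := sum_norm_Fbar_sq_le_torus (d := d) hL j N isUnitaryCfg_flat ((Qcoarse L)^[m] Y)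
    rw [Fbar_flat] at h
    exact h
  have hl2 := l2sq_iterate_Qcoarse_le (d := d) hL m hP (Y := Y) (by rw [← hPe]; exact hY)
  rw [← hPe] at hl2
  calc ∑ z ∈ periodBox (d := d) N, ‖Fcoarse L ((Qcoarse L)^[m] Y) (((L : ℤ) ^ j) • z)‖ ^ 2
      ≤ ((d : ℝ) * L) * l2sq (periodBox (d := d) (L ^ (j + 1) * N)) ((Qcoarse L)^[m] Y) := h1
    _ ≤ ((d : ℝ) * L) * (((L : ℝ) ^ 2 / (L : ℝ) ^ d) ^ m * l2sq (periodBox (d := d) (L ^ (j + 1 + m) * N)) Y) :=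
        mul_le_mul_of_nonneg_left hl2 (by positivity)
    _ = ((d : ℝ) * L) * ((L : ℝ) ^ 2 / (L : ℝ) ^ d) ^ m * l2sq (periodBox (d := d) (L ^ (j + 1 + m) * N)) Y := by ring

/-- **H4♯ — THE SHARP FRAME BOUND (flat)**: for `3 ≤ d`, `2 ≤ L`, `1 ≤ N` and an `(L^k·N)`-periodic `Y`,
`Σ_{z∈periodBox N} ‖framePot L k Y z‖² ≤ 12·(d·L)·Σ_{x∈periodBox (L^k·N)} Σ_κ ‖Y x κ‖²` — H4's `sum_norm_framePot_sq_le` (p225364) with the same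
binders and `Dfp d L` replaced by `d·L` (k-FREE, N-FREE; Sedrakyan with weights `(3∕4)^m` verbatim). [folklore] -/
theorem sum_norm_framePot_sq_le_sharp (hd : 3 ≤ d) {L : ℕ} (hL : 2 ≤ L) {N : ℕ} (hN : 1 ≤ N) (k : ℕ) {Y : Site d → Fin d → Matrix n n ℂ}
    (hY : IsPeriodicDir Y ((L ^ k * N : ℕ) : ℤ)) :
    ∑ z ∈ periodBox (d := d) N, ‖framePot L k Y z‖ ^ 2 ≤ 12 * ((d : ℝ) * L) * l2sq (periodBox (d := d) (L ^ k * N)) Y := by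
  have hL1 : 1 ≤ L := by omega
  have hD0 : 0 ≤ (d : ℝ) * L := by positivity
  have hS0 : 0 ≤ l2sq (periodBox (d := d) (L ^ k * N)) Y := l2sq_nonneg _ _
  rcases Nat.eq_zero_or_pos k with hk | hk
  · subst hk
    have h0 : 0 ≤ 12 * ((d : ℝ) * L) * l2sq (periodBox (d := d) (L ^ 0 * N)) Y := mul_nonneg (mul_nonneg (by norm_num) hD0) hS0
    simpa using h0
  -- notation: the terms `a m z` and the weights `w m = (3/4)^m`
  set ρ2 : ℝ := (L : ℝ) ^ 2 / (L : ℝ) ^ d with hρ2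
  have hρ0 : 0 ≤ ρ2 := by rw [hρ2]; positivity
  have hρq : ρ2 * (4 / 3) ≤ 2 / 3 := ratio_le (d := d) hd hL
  set a : ℕ → Site d → ℝ := fun m z => ‖Fcoarse L ((Qcoarse L)^[m] Y) (((L : ℤ) ^ (k - 1 - m)) • z)‖ with ha
  set w : ℕ → ℝ := fun m => (3 / 4 : ℝ) ^ m with hw
  have hwpos : ∀ m ∈ range k, 0 < w m := fun m _ => by rw [hw]; positivity
  have hwsum : ∑ m ∈ range k, w m ≤ 4 := by
    have := geom_sum_le_inv (q := (3 / 4 : ℝ)) (by norm_num) (by norm_num) k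
    simpa [hw] using this.trans (by norm_num)
  have hwsum0 : 0 < ∑ m ∈ range k, w m := Finset.sum_pos hwpos ⟨0, Finset.mem_range.mpr hk⟩
  -- (1) pointwise: `‖framePot‖ ≤ Σ_m a m z` and Sedrakyan
  have hpt : ∀ z : Site d, ‖framePot L k Y z‖ ^ 2 ≤ 4 * ∑ m ∈ range k, a m z ^ 2 / w m := by
    intro z
    have h1 : ‖framePot L k Y z‖ ≤ ∑ m ∈ range k, a m z := by
      rw [framePot_eq_sum]; exact norm_sum_le _ _
    have h2 := Finset.sq_sum_div_le_sum_sq_div (range k) (fun m => a m z) hwpos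
    have h3 : (∑ m ∈ range k, a m z) ^ 2 ≤ (∑ m ∈ range k, w m) * ∑ m ∈ range k, a m z ^ 2 / w m := by
      rw [div_le_iff₀ hwsum0] at h2; linarith [h2]
    have h4 : 0 ≤ ∑ m ∈ range k, a m z ^ 2 / w m :=
      Finset.sum_nonneg fun m hm => div_nonneg (sq_nonneg _) (hwpos m hm).le
    have h0 : 0 ≤ ‖framePot L k Y z‖ := norm_nonneg _
    calc ‖framePot L k Y z‖ ^ 2 ≤ (∑ m ∈ range k, a m z) ^ 2 := pow_le_pow_left₀ h0 h1 2
      _ ≤ (∑ m ∈ range k, w m) * ∑ m ∈ range k, a m z ^ 2 / w m := h3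
      _ ≤ 4 * ∑ m ∈ range k, a m z ^ 2 / w m := mul_le_mul_of_nonneg_right hwsum h4
  -- (2) the torus sum of each weighted term
  have hterm : ∀ m ∈ range k, ∑ z ∈ periodBox (d := d) N, a m z ^ 2 / w m
      ≤ ((d : ℝ) * L) * (2 / 3 : ℝ) ^ m * l2sq (periodBox (d := d) (L ^ k * N)) Y := by
    intro m hm
    have hmk : m < k := Finset.mem_range.mp hm
    have hjm : k - 1 - m + 1 + m = k := by omega
    have hY' : IsPeriodicDir Y ((L ^ (k - 1 - m + 1 + m) * N : ℕ) : ℤ) := by rw [hjm]; exact hY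
    have h := sum_norm_Fcoarse_iterate_sq_le_sharp (d := d) hL1 hN (k - 1 - m) m hY'
    rw [hjm] at h
    rw [← Finset.sum_div]
    have hw' : w m = (3 / 4 : ℝ) ^ m := rfl
    rw [div_le_iff₀ (hwpos m hm), hw']
    calc ∑ z ∈ periodBox (d := d) N, a m z ^ 2 ≤ ((d : ℝ) * L) * ρ2 ^ m * l2sq (periodBox (d := d) (L ^ k * N)) Y := h
      _ ≤ ((d : ℝ) * L) * ((2 / 3 : ℝ) ^ m * (3 / 4 : ℝ) ^ m)⁻¹⁻¹ * l2sq (periodBox (d := d) (L ^ k * N)) Y := by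
          rw [inv_inv]
          refine mul_le_mul_of_nonneg_right (mul_le_mul_of_nonneg_left ?_ hD0) hS0
          rw [← mul_pow]
          exact pow_le_pow_left₀ hρ0 (by nlinarith) m
      _ = ((d : ℝ) * L) * (2 / 3 : ℝ) ^ m * l2sq (periodBox (d := d) (L ^ k * N)) Y * (3 / 4 : ℝ) ^ m := by rw [inv_inv]; ring
  -- (3) assemble
  have hgeo : ∑ m ∈ range k, (2 / 3 : ℝ) ^ m ≤ 3 := by
    have := geom_sum_le_inv (q := (2 / 3 : ℝ)) (by norm_num) (by norm_num) k
    exact this.trans (by norm_num)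
  calc ∑ z ∈ periodBox (d := d) N, ‖framePot L k Y z‖ ^ 2
      ≤ ∑ z ∈ periodBox (d := d) N, 4 * ∑ m ∈ range k, a m z ^ 2 / w m := Finset.sum_le_sum fun z _ => hpt z
    _ = 4 * ∑ m ∈ range k, ∑ z ∈ periodBox (d := d) N, a m z ^ 2 / w m := by rw [← Finset.mul_sum, Finset.sum_comm]
    _ ≤ 4 * ∑ m ∈ range k, ((d : ℝ) * L) * (2 / 3 : ℝ) ^ m * l2sq (periodBox (d := d) (L ^ k * N)) Y :=
        mul_le_mul_of_nonneg_left (Finset.sum_le_sum hterm) (by norm_num)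
    _ = 4 * (((d : ℝ) * L) * l2sq (periodBox (d := d) (L ^ k * N)) Y) * ∑ m ∈ range k, (2 / 3 : ℝ) ^ m := by
        simp only [Finset.mul_sum]; exact Finset.sum_congr rfl fun m _ => by ring
    _ ≤ 4 * (((d : ℝ) * L) * l2sq (periodBox (d := d) (L ^ k * N)) Y) * 3 :=
        mul_le_mul_of_nonneg_left hgeo (by positivity)
    _ = 12 * ((d : ℝ) * L) * l2sq (periodBox (d := d) (L ^ k * N)) Y := by ring

end

end Summit.QuantumFields.BalabanUV.T4Continuum.NE3FramePotBoundSharp
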